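import Summits.BirchSwinnertonDyer.Rank1Residual.Additive.KatoDescentPerrinRiouRatioRankOne
import Summits.BirchSwinnertonDyer.Rank1Residual.Additive.KatoDescentRankOnePerrinRiouRatio
import Summits.BirchSwinnertonDyer.Rank1Residual.X12.ClassClosureO10RubinEta
import HarnessLib

set_option linter.dupNamespace false
set_option autoImplicit false

/-!
# `CccOneLawOnTypeIstarZero` (stmt-BirchSwinnertonDyer-19223), line `kato_perrin_riou_istar` v11 —
# research stub 1 `stub_perrinRiouRatioIstarZero` SPLITS as (E) realisability ∧ (NV) non-vanishing ∧ (VAL) valuation,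
# recomposed through the tree's PR-INV (kernel glue for a rule-(ii) split; nothing asserted)

Refill hand `leafhand-bsd-inertbadsignedbran-6` g0 (prover), 2026-08-31; DEF-FREE helper `--supports 19223 --as helper`.
Skeleton of record v11 `d5290a4395abfc6e`.  Nothing registered, no stub closed; BSD is proved for no curve.

## What this file proves (kernel)

The registered research stub 1 is `PerrinRiouUpToUnitAt Kato2004.PRRatio W p` on the rows `(p ≥ 5, I₀*, r_an = 1)`, i.e.
(`Additive.perrinRiouUpToUnitAt_prRatio_iff`) «`r_an = 1 → ∃ ℒ, PRRatio W p ℒ ∧ ℒ ≠ 0 ∧ ∃ q, L′(W,1)/(Ω_W·Reg W) = q ∧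
v(ℒ) = v_p(q)`».  It MIXES a print-by-proof existence clause with the research content (director RESTUB rule (ii)):

* (E)   `∃ ℒ, Kato2004.PRRatio W p ℒ` — realisability of the value-pinned Kato zeta datum with its Perrin-Riou ratio
        (PRINT-BY-PROOF: module docstring of `Kato2004/PerrinRiouRatio.lean`, «JUNK AUDIT … REALISABLE by PRINT»; the
        reading `TorsionFree.HasPRRatio Kato2004.PRRatio` of the descent files);
* (NV)  `∀ ℒ, PRRatio W p ℒ → ℒ ≠ 0` — Perrin-Riou's NON-VANISHING (Burns–Kurihara–Sano Conj. 2.8 (i));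
* (VAL) `∀ ℒ, PRRatio W p ℒ → ∃ q, L′(W,1)/(Ω_W·Reg W) = q ∧ v(ℒ) = v_p(q)` — Conj. 2.8 (ii) up to a `p`-adic unit.

`perrinRiouUpToUnitAt_iff_exists_and_forall`: for a globally minimal `W` of analytic rank one and any prime `p`, GRANTED
modularity (`exists_isNewformOf`) and GZK (`rank_eq_analyticRank_of_analyticRank_le_one`: Mordell–Weil rank one and `Ш(W)`
finite), `PerrinRiouUpToUnitAt Kato2004.PRRatio W p ↔ (E) ∧ (NV) ∧ (VAL)` — because any two Perrin-Riou ratios of `(W, p)`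
differ by a `p`-adic unit (the tree THEOREM PR-INV `PerrinRiouUnit.prInv_of_modularity_of_rankOne`, Kato-rigidity at rank one),
and a unit changes neither `ℒ ≠ 0` nor `v(ℒ)`.  `…_onType_IstarZero`: the same on the rows of the line, in the binders of
`KatoPerrinRiouIstar.stub_perrinRiouRatioIstarZero` (both named facts are already in the line: `stub_printFactsKato.2.1`,
`stub_printInputsInert.2`).  So a v12 may register `stub_hasPRRatioIstarZero` [(E), print-by-proof, typer] +
`stub_perrinRiouNonvanishingIstarZero` [(NV), research] + `stub_perrinRiouValuationIstarZero` [(VAL), research] and recompose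
stub 1's exact type in-file by `(perrinRiouUpToUnitAt_iff_exists_and_forall_onType_IstarZero …).mpr`.
Honest label: bookkeeping only; (E), (NV), (VAL) are NOT asserted; closes no stub; 19223 stays OPEN.
-/

noncomputable section

open scoped Classical

open WeierstrassCurve Literature.NumberTheory.EllipticCurves Literature.NumberTheory.EllipticCurves.ModularForms
  Literature.NumberTheory.EllipticCurves.Rank1Residual Literature.NumberTheory.EllipticCurves.Rank1Residual.Typed
open Summit.BirchSwinnertonDyer.Rank1Residual Summit.BirchSwinnertonDyer.Rank1Residual.Additive
open Summit.BirchSwinnertonDyer.Rank1Residual.X12.O10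

namespace Summit.BirchSwinnertonDyer.BirchSwinnertonDyer.Theorems.CccOnePerrinRiouSplit

variable (W : WeierstrassCurve ℚ) [W.IsElliptic] [W.IsGloballyMinimal] (p : ℕ) [Fact p.Prime]

/-- A `p`-adic number of norm `1` is non-zero and multiplying by it does not change the valuation. [folklore] -/
theorem valuation_mul_eq_of_norm_eq_one {w ℒ : ℚ_[p]} (hw : ‖w‖ = 1) (hℒ : ℒ ≠ 0) :
    w * ℒ ≠ 0 ∧ (w * ℒ).valuation = ℒ.valuation := by
  have hw0 : w ≠ 0 := by
    intro h; rw [h, norm_zero] at hw; exact zero_ne_one hw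
  refine ⟨mul_ne_zero hw0 hℒ, ?_⟩
  have hv : w.valuation = 0 := by
    have h := Padic.norm_eq_zpow_neg_valuation hw0
    rw [hw] at h
    have hp : (1 : ℝ) < p := by exact_mod_cast (Fact.out : p.Prime).one_lt
    have := zpow_right_injective₀ (by positivity) hp.ne' (h.symm.trans (zpow_zero _).symm)
    omega
  rw [Padic.valuation_mul hw0 hℒ, hv, zero_add]

/-- **Stub 1 ⟺ (E) ∧ (NV) ∧ (VAL)** for a globally minimal `W/ℚ` of analytic rank one and any prime `p`, granted modularity
and GZK: Perrin-Riou's conjecture up to a `p`-adic unit over Kato's ratio (`PerrinRiouUpToUnitAt Kato2004.PRRatio W p`) holds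
IFF some Perrin-Riou ratio exists (E) AND every Perrin-Riou ratio is non-zero (NV) with the Burns–Kurihara–Sano valuation
(VAL).  `→`: any two ratios differ by a norm-one factor (PR-INV, `PerrinRiouUnit.prInv_of_modularity_of_rankOne`, from
Mordell–Weil rank one and `Ш(W)[p^∞]` finite = GZK at `r_an = 1`); `←`: trivial.  Conditional on the two named facts; nothing
asserted about (E)/(NV)/(VAL). [cite: BurnsKuriharaSano2019, Conj. 2.8 (i)–(ii) (p. 10), Thm. 1.4 (p. 4)] [cite: PerrinRiou1993AIF, §3.3]
[cite: Kato2004Asterisque, Thm. 12.4 (2) and Thm. 12.5 (1) (p. 221), §13.9 (p. 230)] [cite: Darmon2004, Thm. 3.22] -/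
theorem perrinRiouUpToUnitAt_iff_exists_and_forall (hmod : exists_isNewformOf)
    (hGZK : rank_eq_analyticRank_of_analyticRank_le_one) (hr : W.analyticRank = 1) :
    PerrinRiouUpToUnitAt Kato2004.PRRatio W p ↔
      ((∃ ℒ : ℚ_[p], Kato2004.PRRatio W p ℒ) ∧
        (∀ ℒ : ℚ_[p], Kato2004.PRRatio W p ℒ → ℒ ≠ 0) ∧
        ∀ ℒ : ℚ_[p], Kato2004.PRRatio W p ℒ →
          ∃ q : ℚ, W.leadingLCoeff / ((W.realPeriodRat : ℂ) * (W.regulator : ℂ)) = (q : ℂ) ∧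
            ℒ.valuation = padicValRat p q) := by
  -- GZK on the curve: Mordell–Weil rank one and `Ш(W)` finite, hence `Ш(W)[p^∞]` finite
  obtain ⟨hmw, hfinSha⟩ := hGZK W (by rw [hr])
  have hrk : W.mordellWeilRank = 1 := by rw [hmw, hr]
  haveI : Finite W.sha := hfinSha
  have hsha : Finite (AddCommGroup.primaryComponent W.sha p) := inferInstance
  have hinv := PerrinRiouUnit.prInv_of_modularity_of_rankOne hmod W p
  constructor
  · intro h
    obtain ⟨ℒ₀, hℒ₀, hne, q, hq, hv⟩ := h hr
    refine ⟨⟨ℒ₀, hℒ₀⟩, fun ℒ hℒ => ?_, fun ℒ hℒ => ?_⟩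
    · obtain ⟨w, hw, rfl⟩ := hinv ℒ₀ ℒ hrk hsha hℒ₀ hℒ
      exact (valuation_mul_eq_of_norm_eq_one p hw hne).1
    · obtain ⟨w, hw, rfl⟩ := hinv ℒ₀ ℒ hrk hsha hℒ₀ hℒ
      exact ⟨q, hq, by rw [(valuation_mul_eq_of_norm_eq_one p hw hne).2, hv]⟩
  · rintro ⟨⟨ℒ, hℒ⟩, hNV, hVAL⟩ _
    obtain ⟨q, hq, hv⟩ := hVAL ℒ hℒ
    exact ⟨ℒ, hℒ, hNV ℒ hℒ, q, hq, hv⟩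

/-- **On the rows of the line** (`p ≥ 5`, signed type `(p, I₀*)`, analytic rank one): the registered research stub 1
`KatoPerrinRiouIstar.stub_perrinRiouRatioIstarZero` — its type VERBATIM on the left — is equivalent, granted modularity and GZK
(the line's `stub_printFactsKato.2.1` and `stub_printInputsInert.2`), to the conjunction of the three row statements (E), (NV),
(VAL).  Kernel glue for a rule-(ii) split of stub 1; nothing asserted. [cite: BurnsKuriharaSano2019, Conj. 2.8 (i)–(ii) (p. 10)]
[cite: Kato2004Asterisque, Thm. 12.5 (1) (p. 221), §13.9 (p. 230)] [cite: PerrinRiou1993AIF, §3.3] -/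
theorem perrinRiouUpToUnitAt_iff_exists_and_forall_onType_IstarZero (hmod : exists_isNewformOf)
    (hGZK : rank_eq_analyticRank_of_analyticRank_le_one) :
    (∀ (p : ℕ) [Fact p.Prime], 5 ≤ p → ∀ (W : WeierstrassCurve ℚ) [W.IsElliptic] [W.IsGloballyMinimal],
        HasSignedLocalType W p (.Istar 0) → W.analyticRank = 1 → PerrinRiouUpToUnitAt Kato2004.PRRatio W p) ↔
      ((∀ (p : ℕ) [Fact p.Prime], 5 ≤ p → ∀ (W : WeierstrassCurve ℚ) [W.IsElliptic] [W.IsGloballyMinimal],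
          HasSignedLocalType W p (.Istar 0) → W.analyticRank = 1 → ∃ ℒ : ℚ_[p], Kato2004.PRRatio W p ℒ) ∧
        (∀ (p : ℕ) [Fact p.Prime], 5 ≤ p → ∀ (W : WeierstrassCurve ℚ) [W.IsElliptic] [W.IsGloballyMinimal],
          HasSignedLocalType W p (.Istar 0) → W.analyticRank = 1 →
            ∀ ℒ : ℚ_[p], Kato2004.PRRatio W p ℒ → ℒ ≠ 0) ∧
        (∀ (p : ℕ) [Fact p.Prime], 5 ≤ p → ∀ (W : WeierstrassCurve ℚ) [W.IsElliptic] [W.IsGloballyMinimal],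
          HasSignedLocalType W p (.Istar 0) → W.analyticRank = 1 →
            ∀ ℒ : ℚ_[p], Kato2004.PRRatio W p ℒ →
              ∃ q : ℚ, W.leadingLCoeff / ((W.realPeriodRat : ℂ) * (W.regulator : ℂ)) = (q : ℂ) ∧
                ℒ.valuation = padicValRat p q)) := by
  constructor
  · intro h
    refine ⟨fun p _ hp W _ _ hT hr => ?_, fun p _ hp W _ _ hT hr => ?_, fun p _ hp W _ _ hT hr => ?_⟩
    · exact ((perrinRiouUpToUnitAt_iff_exists_and_forall W p hmod hGZK hr).mp (h p hp W hT hr)).1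
    · exact ((perrinRiouUpToUnitAt_iff_exists_and_forall W p hmod hGZK hr).mp (h p hp W hT hr)).2.1
    · exact ((perrinRiouUpToUnitAt_iff_exists_and_forall W p hmod hGZK hr).mp (h p hp W hT hr)).2.2
  · rintro ⟨hE, hNV, hVAL⟩ p _ hp W _ _ hT hr
    exact (perrinRiouUpToUnitAt_iff_exists_and_forall W p hmod hGZK hr).mpr
      ⟨hE p hp W hT hr, hNV p hp W hT hr, hVAL p hp W hT hr⟩

end Summit.BirchSwinnertonDyer.BirchSwinnertonDyer.Theorems.CccOnePerrinRiouSplit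

end
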